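import Summits.AtomisticToContinuum.HydrodynamicLimit.Theorems.LambertianContactSwapLambertianEulerKineticInputs
import HarnessLib

/-!
# The Euler-free core of TL1G-Λ from `N`-uniform propagation of a Gaussian velocity moment along `Λ`
# (crux `LambertianEuler`, stmt-AtomisticToContinuum-11854, line `Sketch`)

Support file (`--supports stmt-AtomisticToContinuum-11854`).  Registered sub-goal
`gaussianVelocityTailsCore_of_expMoment` (S3 of lead c9) of the research input TL1G-Λ
(`…KineticInputs.GaussianVelocityTailsLambda`).  The Euler-free core of TL1G-Λ (Gaussian `L¹` tails, with the
cubic weight, of the SPEEDS `‖v_i(r′)‖` along the Lambertian hard-sphere flow `Λ = lambertFlow` driven by the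
Lambertian noise `γ^ℕ = lambertNoise`, started from local Gibbs data `localGibbsLaw σ a₀ u₀ θ₀ N (Φ N)`,
eventually in `N`, uniformly on `[0, t]`) follows from the cleanest dynamical statement: `N`-UNIFORM propagation of
a Gaussian velocity moment along `Λ`,

  `E ∑ᵢ exp(b ‖vᵢ(r′)‖²) ≤ C (N + 1)`   for `N ≥ N₀`, `r′ ∈ [0, t]`.

## Proof (Chebyshev)

Pointwise, for `r := ‖v‖` and a level `V ≥ 0`: `(1 + r)³ ≤ e^{3r} ≤ e^{9/(2b)} e^{(b/2) r²}` (a square) and, on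
`{V < r}`, `1 ≤ e^{(b/2)(r² − V²)}`, so `𝟙{V < r}(1 + r)³ ≤ e^{9/(2b)} e^{−(b/2)V²} e^{b r²}`
(`speedTail_le_exp`).  Summing over `i` and integrating, the Bochner integral of the (nonnegative) core integrand is
bounded by the lower Lebesgue integral of the dominating function (`norm_integral_le_lintegral_norm`, no
measurability needed), i.e. by `e^{9/(2b)} e^{−(b/2)V²} · E ∑ᵢ e^{b‖vᵢ(r′)‖²} ≤ e^{9/(2b)} e^{−(b/2)V²} C⁺ (N + 1)`.
Constants: `A := e^{9/(2b)} (C⁺ + 1)`, `a := b/2`, the same `σ₀` and `N₀`.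

References: H. Spohn, *Large Scale Dynamics of Interacting Particles* (1991), Part I §2.3 (Gaussian velocity
moments of Gibbs states); measure theory otherwise.  All `[folklore]`.
-/

noncomputable section

namespace Summit.AtomisticToContinuum.HydrodynamicLimit.Theorems.LambertianContactSwapLambertianEulerGaussianTailsExpMoment

open scoped BigOperators Topology ENNReal InnerProductSpace
open MeasureTheory ProbabilityTheory Filter Set InformationTheory
open Literature.MathematicalPhysics.KineticTheory
open Literature.Analysis.FluidPDE Literature.Analysis.FluidPDE.Alexander

/-! ## The pointwise Chebyshev domination -/

/-- **Gaussian domination of the cubic-weighted speed-tail indicator.**  For `b > 0`, `V ≥ 0`, `r ≥ 0`: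
`𝟙{V < r} (1 + r)³ ≤ e^{9/(2b)} · e^{−(b/2)V²} · e^{b r²}` — from `(1 + r)³ ≤ e^{3r}` (`Real.add_one_le_exp`),
`3r ≤ (b/2) r² + 9/(2b)` (the square `(b/2)(r − 3/b)² ≥ 0`) and `V² ≤ r²` on `{V < r}`. [folklore] -/
theorem speedTail_le_exp {b V r : ℝ} (hb : 0 < b) (hV : 0 ≤ V) (hr : 0 ≤ r) :
    (if V < r then (1 + r) ^ 3 else 0 : ℝ) ≤
      Real.exp (9 / (2 * b)) * Real.exp (-(b / 2 * V ^ 2)) * Real.exp (b * r ^ 2) := by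
  split_ifs with h
  · have h1 : (1 + r) ^ 3 ≤ Real.exp (3 * r) := by
      have h0 : 1 + r ≤ Real.exp r := by linarith [Real.add_one_le_exp r]
      calc (1 + r) ^ 3 ≤ (Real.exp r) ^ 3 := pow_le_pow_left₀ (by positivity) h0 3
        _ = Real.exp (3 * r) := by rw [← Real.exp_nat_mul]; norm_num
    rw [← Real.exp_add, ← Real.exp_add]
    refine h1.trans (Real.exp_le_exp.2 ?_)
    have hV2 : V ^ 2 ≤ r ^ 2 := by nlinarith
    have hsq : b / 2 * (r - 3 / b) ^ 2 = b / 2 * r ^ 2 - 3 * r + 9 / (2 * b) := by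
      field_simp
      ring
    have hkey : 3 * r ≤ b / 2 * r ^ 2 + 9 / (2 * b) := by
      have h2 : 0 ≤ b / 2 * (r - 3 / b) ^ 2 := by positivity
      linarith
    nlinarith
  · positivity

/-! ## The registered sub-goal -/

/-- **The Euler-free core of TL1G-Λ from `N`-uniform Gaussian moment propagation (Chebyshev).**  If, for continuous
positive local Gibbs data and small `σ`, along the Lambertian flow `Λ` the Gaussian velocity moment propagates
`N`-uniformly, `E ∑ᵢ e^{b‖vᵢ(r′)‖²} ≤ C (N + 1)` for `N ≥ N₀` uniformly in `r′ ∈ [0, t]`, then the cubic-weighted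
speed tails are Gaussian: `E ∑ᵢ 𝟙{V < ‖vᵢ(r′)‖}(1 + ‖vᵢ(r′)‖)³ ≤ A e^{−aV²} (N + 1)` for all `V ≥ 1`, `N ≥ N₀`,
`r′ ∈ [0, t]`, with `A = e^{9/(2b)} (C⁺ + 1)`, `a = b/2` (`speedTail_le_exp`, `norm_integral_le_lintegral_norm`).
[folklore] -/
theorem gaussianVelocityTailsCore_of_expMoment :
    (∀ (a₀ θ₀ : T3 → ℝ) (u₀ : T3 → V3), Continuous a₀ → Continuous θ₀ → Continuous u₀ →
      (∀ x, 0 < a₀ x) → (∀ x, 0 < θ₀ x) →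
      ∃ σ₀ : ℝ, 0 < σ₀ ∧ ∀ σ : ℝ, 0 < σ → σ < σ₀ →
        ∀ Φ : (N : ℕ) → HardSphereFlow (Torus.geometry (Fin 3)) (hsDiameter σ N) (N + 1),
        ∀ t : ℝ, 0 < t → ∃ b : ℝ, 0 < b ∧ ∃ C : ℝ, ∃ N₀ : ℕ, ∀ N : ℕ, N₀ ≤ N → ∀ r' ∈ Set.Icc 0 t,
          ∫⁻ p, (∑ i : Fin (N + 1),
              ENNReal.ofReal (Real.exp (b * ‖(lambertFlow (Torus.geometry (Fin 3)) (hsDiameter σ N) p.2 p.1 r' i).2‖ ^ 2)))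
            ∂((localGibbsLaw σ a₀ u₀ θ₀ N (Φ N)).prod (lambertNoise (Fin 3))) ≤ ENNReal.ofReal (C * ((N : ℝ) + 1))) →
    (∀ (a₀ θ₀ : T3 → ℝ) (u₀ : T3 → V3), Continuous a₀ → Continuous θ₀ → Continuous u₀ →
      (∀ x, 0 < a₀ x) → (∀ x, 0 < θ₀ x) →
      ∃ σ₀ : ℝ, 0 < σ₀ ∧ ∀ σ : ℝ, 0 < σ → σ < σ₀ →
        ∀ Φ : (N : ℕ) → HardSphereFlow (Torus.geometry (Fin 3)) (hsDiameter σ N) (N + 1),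
        ∀ t : ℝ, 0 < t → ∃ A a : ℝ, 0 < A ∧ 0 < a ∧ ∀ V : ℝ, 1 ≤ V → ∃ N₀ : ℕ, ∀ N : ℕ, N₀ ≤ N →
          ∀ r' ∈ Set.Icc 0 t,
            ∫ p, (∑ i : Fin (N + 1),
                if V < ‖(lambertFlow (Torus.geometry (Fin 3)) (hsDiameter σ N) p.2 p.1 r' i).2‖ then
                  (1 + ‖(lambertFlow (Torus.geometry (Fin 3)) (hsDiameter σ N) p.2 p.1 r' i).2‖) ^ 3 else 0)
              ∂((localGibbsLaw σ a₀ u₀ θ₀ N (Φ N)).prod (lambertNoise (Fin 3))) ≤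
            A * Real.exp (-(a * V ^ 2)) * ((N : ℝ) + 1)) := by
  intro h a₀ θ₀ u₀ ha hθ hu ha0 hθ0
  obtain ⟨σ₀, hσ₀, H⟩ := h a₀ θ₀ u₀ ha hθ hu ha0 hθ0
  refine ⟨σ₀, hσ₀, fun σ hσ hσlt Φ t ht => ?_⟩
  obtain ⟨b, hb, C, N₀, HC⟩ := H σ hσ hσlt Φ t ht
  refine ⟨Real.exp (9 / (2 * b)) * (max C 0 + 1), b / 2, by positivity, by positivity,
    fun V hV => ⟨N₀, fun N hN r' hr' => ?_⟩⟩
  have hHC := HC N hN r' hr'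
  -- abbreviations
  set K : ℝ := Real.exp (9 / (2 * b)) with hK
  set μ := (localGibbsLaw σ a₀ u₀ θ₀ N (Φ N)).prod (lambertNoise (Fin 3)) with hμ
  set Λ : Config (N + 1) (Fin 3) T3 × (ℕ → V3) → Config (N + 1) (Fin 3) T3 :=
    fun p => lambertFlow (Torus.geometry (Fin 3)) (hsDiameter σ N) p.2 p.1 r' with hΛ
  set F : Config (N + 1) (Fin 3) T3 × (ℕ → V3) → ℝ := fun p => ∑ i : Fin (N + 1),
    (if V < ‖(Λ p i).2‖ then (1 + ‖(Λ p i).2‖) ^ 3 else 0) with hF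
  show ∫ p, F p ∂μ ≤ K * (max C 0 + 1) * Real.exp (-(b / 2 * V ^ 2)) * ((N : ℝ) + 1)
  have hc : 0 < K * Real.exp (-(b / 2 * V ^ 2)) := by positivity
  have hn : (0 : ℝ) ≤ (N : ℝ) + 1 := by positivity
  have hF0 : ∀ p, 0 ≤ F p := fun p => Finset.sum_nonneg fun i _ => by positivity
  -- the main estimate, in `ℝ≥0∞`
  have hmain : ∫⁻ p, ENNReal.ofReal ‖F p‖ ∂μ ≤
      ENNReal.ofReal (K * Real.exp (-(b / 2 * V ^ 2)) * (max C 0 * ((N : ℝ) + 1))) := by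
    calc ∫⁻ p, ENNReal.ofReal ‖F p‖ ∂μ
        ≤ ∫⁻ p, ENNReal.ofReal (K * Real.exp (-(b / 2 * V ^ 2))) *
            (∑ i : Fin (N + 1), ENNReal.ofReal (Real.exp (b * ‖(Λ p i).2‖ ^ 2))) ∂μ := by
          refine lintegral_mono fun p => ?_
          rw [Real.norm_of_nonneg (hF0 p)]
          calc ENNReal.ofReal (F p)
              ≤ ENNReal.ofReal (∑ i : Fin (N + 1), K * Real.exp (-(b / 2 * V ^ 2)) *
                  Real.exp (b * ‖(Λ p i).2‖ ^ 2)) :=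
                ENNReal.ofReal_le_ofReal (Finset.sum_le_sum fun i _ =>
                  speedTail_le_exp hb (zero_le_one.trans hV) (norm_nonneg _))
            _ = ENNReal.ofReal (K * Real.exp (-(b / 2 * V ^ 2))) *
                  ∑ i : Fin (N + 1), ENNReal.ofReal (Real.exp (b * ‖(Λ p i).2‖ ^ 2)) := by
                rw [ENNReal.ofReal_sum_of_nonneg fun i _ => by positivity, Finset.mul_sum]
                exact Finset.sum_congr rfl fun i _ => ENNReal.ofReal_mul hc.le
      _ = ENNReal.ofReal (K * Real.exp (-(b / 2 * V ^ 2))) *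
            ∫⁻ p, (∑ i : Fin (N + 1), ENNReal.ofReal (Real.exp (b * ‖(Λ p i).2‖ ^ 2))) ∂μ :=
          lintegral_const_mul' _ _ ENNReal.ofReal_ne_top
      _ ≤ ENNReal.ofReal (K * Real.exp (-(b / 2 * V ^ 2))) * ENNReal.ofReal (max C 0 * ((N : ℝ) + 1)) := by
          gcongr
          exact hHC.trans (ENNReal.ofReal_le_ofReal (mul_le_mul_of_nonneg_right (le_max_left _ _) hn))
      _ = ENNReal.ofReal (K * Real.exp (-(b / 2 * V ^ 2)) * (max C 0 * ((N : ℝ) + 1))) :=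
          (ENNReal.ofReal_mul hc.le).symm
  -- conclusion
  calc ∫ p, F p ∂μ ≤ ‖∫ p, F p ∂μ‖ := Real.le_norm_self _
    _ ≤ (∫⁻ p, ENNReal.ofReal ‖F p‖ ∂μ).toReal := norm_integral_le_lintegral_norm F
    _ ≤ K * Real.exp (-(b / 2 * V ^ 2)) * (max C 0 * ((N : ℝ) + 1)) :=
        ENNReal.toReal_le_of_le_ofReal (by positivity) hmain
    _ ≤ K * (max C 0 + 1) * Real.exp (-(b / 2 * V ^ 2)) * ((N : ℝ) + 1) := by
        have h1 : K * (max C 0 + 1) * Real.exp (-(b / 2 * V ^ 2)) * ((N : ℝ) + 1) =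
            K * Real.exp (-(b / 2 * V ^ 2)) * (max C 0 * ((N : ℝ) + 1)) +
              K * Real.exp (-(b / 2 * V ^ 2)) * ((N : ℝ) + 1) := by ring
        rw [h1]
        linarith [mul_nonneg hc.le hn]

end Summit.AtomisticToContinuum.HydrodynamicLimit.Theorems.LambertianContactSwapLambertianEulerGaussianTailsExpMoment

end
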